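import Literature.Computability.Complexity.ACFourierTails
import Mathlib.Algebra.Order.Field.GeomSum

/-!
# Route OneSlice, crux `SliceACZero` (stmt-PneNP-2835), line `russo-window-ladder`: stub `stub_talInfluence`

Summed Fourier tails of bounded-depth circuits from the in-tree Tal theorem: for every depth `d` there are `K_d, B_d`
(here `B_d = d`, `K_d = 8^{d+2} · 16896^{d+2} · 3^d / ln 2`) such that every circuit `C` over `acBasis` on `Fin m` of
`acDepth ≤ d` has `Σ_{k=1}^{m} W^{≥k}[sgn ∘ C.eval] ≤ K_d (log(|C|+2))^{B_d}` (Linial–Mansour–Nisan 1993 / Boppana 1997 /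
Tal 2017 strength; any polylog suffices downstream). Route: `Circuit.exists_acForm` (height `≤ acDepth + 1`, width `≤ 1`,
esize `≤ 2s`), `ACForm.tailWeight_le_tailBound` with `M := 2s+1`, `d' := d+2`, `t := 1`, the geometric series
`Σ_{k ≥ 1} e^{−ak} ≤ 1/a` (`geom_sum_Ico_le_of_lt_one`, `Real.add_one_le_exp`), and `logM(2s+1) ≤ 3 log(s+2)`.
The registered stub `stub_talInfluence` (skeleton `Cruxes/SliceACZero/Lines/russo-window-ladder.lean`, consumed by
`boppana_of`) is the last theorem.

Proofs adapted from the refuter's kernel-checked candidate `Cruxes/SliceACZero/DrefuteG3RussoWindowLadderComplete.lean`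
(refuter-drefute-stmt-PneNP-2835-g3-0, namespace `…DrefuteG3Complete.S4b`), relocated to the line namespace.
-/

noncomputable section

namespace Summit.PneNP.PneNP.Cruxes.SliceACZero.RussoWindowLadder

set_option linter.dupNamespace false

namespace TalInfluence

open Finset Literature.Computability.Complexity
open Literature.Computability.Complexity.LowDegree (tailWeight tailWeight_nonneg)
open Literature.Probability.RandomGraphs.LowDegree (sgn)
open Literature.Computability.Complexity.ACForm

/-- **Core summation.** A layered formula of height `≤ d'` (`d' ≥ 2`), effective size `≤ M` (`M ≥ 1`) and bottom
fan-in `≤ 1` has `Σ_{k=1}^{m} W^{≥k} ≤ 8^{d'} cB^{d'} (logM M)^{d'-2} / ln 2` (Tal's per-level bound summed as a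
geometric series). [cite: Tal2017, Theorem 3.6] -/
theorem sum_tailWeight_le_core {m M d' : ℕ} (hM : 1 ≤ M) (hd' : 2 ≤ d') (f : ACForm m)
    (hh : f.height ≤ d') (hs : f.esize ≤ M) (hw : f.width ≤ 1) :
    ∑ k ∈ Finset.Icc 1 m, tailWeight (sgnEval f) k ≤
      (cA : ℝ) ^ d' * (cB : ℝ) ^ d' / Real.log 2 * ((logM M : ℕ) : ℝ) ^ (d' - 2) := by
  set ℓ : ℕ := logM M with hℓ
  have hℓ1 : 1 ≤ ℓ := one_le_logM hM
  have hl2 := Real.log_two_gt_d9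
  have hlog2 : 0 < Real.log 2 := by linarith
  have hcA : (0 : ℝ) < cA := by unfold cA; norm_num
  have hcB : (0 : ℝ) < cB := by unfold cB B0; norm_num
  have hℓpos : (0 : ℝ) < ℓ := by exact_mod_cast hℓ1
  -- the per-level bound from the in-tree Tal theorem
  have per : ∀ k, tailWeight (sgnEval f) k ≤ tailBound ℓ d' 1 k :=
    tailWeight_le_tailBound hM d' hd' f 1 le_rfl hℓ1 hh hs hw
  -- `tailBound ℓ d' 1 k = 8^{d'} r^k`, `r = e^{-a}`
  set a : ℝ := Real.log 2 / ((cB : ℝ) ^ d' * (ℓ : ℝ) ^ (d' - 2)) with ha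
  have hden : 0 < (cB : ℝ) ^ d' * (ℓ : ℝ) ^ (d' - 2) := by positivity
  have ha0 : 0 < a := div_pos hlog2 hden
  set r : ℝ := Real.exp (-a) with hr
  have hr0 : 0 ≤ r := (Real.exp_pos _).le
  have hr1 : r < 1 := Real.exp_lt_one_iff.2 (by linarith)
  have htb : ∀ k : ℕ, tailBound ℓ d' 1 k = (cA : ℝ) ^ d' * r ^ k := by
    intro k
    rw [hr, ← Real.exp_nat_mul, tailBound, Nat.cast_one, mul_one]
    congr 2
    rw [ha]
    ring
  -- geometric series
  have hIcc : Finset.Icc 1 m = Finset.Ico 1 (m + 1) := by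
    ext k; simp only [Finset.mem_Icc, Finset.mem_Ico]; omega
  have hgeom : ∑ k ∈ Finset.Icc 1 m, r ^ k ≤ r / (1 - r) := by
    rw [hIcc]
    simpa using geom_sum_Ico_le_of_lt_one (m := 1) (n := m + 1) hr0 hr1
  have hra : r / (1 - r) ≤ 1 / a := by
    have h1 : r * (a + 1) ≤ 1 := by
      calc r * (a + 1) ≤ r * Real.exp a := mul_le_mul_of_nonneg_left (Real.add_one_le_exp a) hr0
        _ = 1 := by rw [hr, ← Real.exp_add, neg_add_cancel, Real.exp_zero]
    rw [div_le_div_iff₀ (by linarith) ha0]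
    nlinarith
  calc ∑ k ∈ Finset.Icc 1 m, tailWeight (sgnEval f) k
      ≤ ∑ k ∈ Finset.Icc 1 m, (cA : ℝ) ^ d' * r ^ k :=
        Finset.sum_le_sum fun k _ => (per k).trans (le_of_eq (htb k))
    _ = (cA : ℝ) ^ d' * ∑ k ∈ Finset.Icc 1 m, r ^ k := by rw [Finset.mul_sum]
    _ ≤ (cA : ℝ) ^ d' * (1 / a) := mul_le_mul_of_nonneg_left (hgeom.trans hra) (by positivity)
    _ = (cA : ℝ) ^ d' * (cB : ℝ) ^ d' / Real.log 2 * (ℓ : ℝ) ^ (d' - 2) := by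
        rw [ha]; field_simp

/-- The bound of the stub, inner form: the summed Fourier tails
`Σ_{k=1}^{m} W^{≥k}[sgn ∘ C]` of an `acBasis` circuit of `acDepth ≤ d` on `Fin m` are at most `K_d (log(|C|+2))^{d}`,
uniformly in `m`. [cite: Tal2017, Theorem 3.6] -/
theorem talInfluence :
    ∀ d : ℕ, ∃ K : ℝ, ∃ B : ℕ, ∀ (m : ℕ) (C : Circuit (Fin m)), C.IsOver acBasis → C.acDepth ≤ d →
      ∑ k ∈ Finset.Icc 1 m, tailWeight (fun x => sgn (C.eval x)) k ≤
        K * Real.log ((C.size : ℝ) + 2) ^ B := by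
  intro d
  refine ⟨(cA : ℝ) ^ (d + 2) * (cB : ℝ) ^ (d + 2) / Real.log 2 * (3 : ℝ) ^ d, d, fun m C hC hd => ?_⟩
  obtain ⟨f, hev, hh, hw, hsize⟩ := C.exists_acForm hC
  have hfun : (fun x => sgn (C.eval x)) = sgnEval f := by funext x; rw [sgnEval, hev]
  rw [hfun]
  set s : ℕ := C.size with hs
  have hM1 : 1 ≤ 2 * s + 1 := by omega
  have hl2 := Real.log_two_gt_d9
  have hlog2 : 0 < Real.log 2 := by linarith
  have hcA : (0 : ℝ) < cA := by unfold cA; norm_num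
  have hcB : (0 : ℝ) < cB := by unfold cB B0; norm_num
  have core := sum_tailWeight_le_core hM1 (show 2 ≤ d + 2 by omega) f (hh.trans (by omega))
    (hsize.trans (by omega)) hw
  rw [Nat.add_sub_cancel] at core
  set ℓ : ℕ := logM (2 * s + 1) with hℓ
  -- `ℓ ≤ 3 log(s+2)`
  have hs0 : (0 : ℝ) ≤ s := Nat.cast_nonneg _
  have hL0 : 0 ≤ Real.log ((s : ℝ) + 2) := Real.log_nonneg (by linarith)
  have hℓL : (ℓ : ℝ) ≤ 3 * Real.log ((s : ℝ) + 2) := by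
    have hpow : (2 : ℝ) ^ ℓ ≤ 2 * s + 2 := by
      have := Nat.pow_log_le_self 2 (show 2 * s + 1 + 1 ≠ 0 by omega)
      rw [hℓ, logM]
      exact_mod_cast this
    have h1 : (ℓ : ℝ) * Real.log 2 ≤ Real.log (2 * s + 2) := by
      rw [← Real.log_pow]; exact Real.log_le_log (by positivity) hpow
    have h2 : Real.log (2 * (s : ℝ) + 2) ≤ 2 * Real.log ((s : ℝ) + 2) := by
      have e : Real.log (((s : ℝ) + 2) ^ 2) = 2 * Real.log ((s : ℝ) + 2) := by
        rw [Real.log_pow]; norm_num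
      rw [← e]
      exact Real.log_le_log (by positivity) (by nlinarith)
    have h3 : (ℓ : ℝ) * Real.log 2 ≤ 3 * Real.log ((s : ℝ) + 2) * Real.log 2 := by nlinarith
    exact le_of_mul_le_mul_right h3 hlog2
  have hℓd : (ℓ : ℝ) ^ d ≤ (3 * Real.log ((s : ℝ) + 2)) ^ d := pow_le_pow_left₀ (Nat.cast_nonneg _) hℓL d
  calc ∑ k ∈ Finset.Icc 1 m, tailWeight (sgnEval f) k
      ≤ (cA : ℝ) ^ (d + 2) * (cB : ℝ) ^ (d + 2) / Real.log 2 * (ℓ : ℝ) ^ d := core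
    _ ≤ (cA : ℝ) ^ (d + 2) * (cB : ℝ) ^ (d + 2) / Real.log 2 * (3 * Real.log ((s : ℝ) + 2)) ^ d :=
        mul_le_mul_of_nonneg_left hℓd (by positivity)
    _ = (cA : ℝ) ^ (d + 2) * (cB : ℝ) ^ (d + 2) / Real.log 2 * (3 : ℝ) ^ d *
          Real.log ((s : ℝ) + 2) ^ d := by rw [mul_pow]; ring

end TalInfluence

open Finset Literature.Computability.Complexity
open Literature.Computability.Complexity.LowDegree (tailWeight)
open Literature.Probability.RandomGraphs.LowDegree (sgn)

/-- **Stub 4b — summed Fourier tails of bounded-depth `acBasis` circuits** (registered stub of the line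
`russo-window-ladder`): `∀ d ∃ K B ∀ m (C : Circuit (Fin m))`, `C` over `acBasis`, `acDepth ≤ d` ⇒
`Σ_{k=1}^{m} W^{≥k}[sgn ∘ C.eval] ≤ K (log(|C|+2))^B`. [cite: Tal2017, Theorem 3.6] -/
theorem stub_talInfluence :
    ∀ d : ℕ, ∃ K : ℝ, ∃ B : ℕ, ∀ (m : ℕ) (C : Circuit (Fin m)), C.IsOver acBasis → C.acDepth ≤ d →
      ∑ k ∈ Finset.Icc 1 m, tailWeight (fun x => sgn (C.eval x)) k ≤ K * Real.log ((C.size : ℝ) + 2) ^ B :=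
  TalInfluence.talInfluence

end Summit.PneNP.PneNP.Cruxes.SliceACZero.RussoWindowLadder

end
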